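import Summits.QuantumFields.BalabanUV.T4Continuum.Support.NE7PairwiseScaleShift

/-!
# NE7PairwiseMonotone — row NE7 (node U5), route «PAIR-CAUCHY»: the two RATE-FREE producers of a null depth-modulus,
# BY NAME — bounded variation in the depth (route ℓ¹ ∕ LÖW's output currency) and MONOTONE + BOUNDED in the depth (LÖW's
# mechanism) — and their junction with the one-loop half of the marginal ask (σ) of `NE7PairwiseCouplingDock`

Cell `pub-balaban`, rung (B)+1 sub-cell t4, lineage `b2b-balaban-t4-ne7-p2` (CRUX PROVER NE7 #2 under the coordinator
ruling «YM redirect», 2026-08-21; generation 49; route texts `HOME/t4/b2b-balaban-t4-ne7-p2/g48/ROUTE2-NE7-P2.md` v1.3.1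
§2 T.5♭ and `HOME/t4/ROUTES-NE7.md` §L2.1 (ℓ¹) ∕ §L2.2 (LÖW)).  HONEST FRAMING (page 1): FIXED FINITE T⁴, rung (B)+1 =
existence AND uniqueness of the `ε = L^{−K} → 0` limit of unit-scale averaged expectations, CONDITIONAL on BetaPertH and
the nine spine estimates (0/9 proved); NOT infinite volume, NOT a mass gap, NOT the Clay problem.  NE7 is NOT PRINTED in
[Balaban1984PropagatorsI]–[Balaban1989LargeFieldII] and NOT proved here.  Everything below is [folklore] real analysis
(monotone convergence, telescoping) over hypothesis SHAPES; no definition, no cite tag, nothing printed asserted, no `sorry`.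

WHY.  The crux refuter's price of the null currency (PRICING-NE7 v2 §9.4(b)(iii)): «a null two-depth modulus of a
one-step object is the EXISTENCE of its η → 0 limit … in practice every η-row that can deliver «null» will deliver it
THROUGH a rate».  There are exactly two classical mechanisms that deliver a limit WITHOUT a rate and WITHOUT identifying
the limit, and both are already named in the cell: BOUNDED VARIATION in the depth (route ℓ¹'s currency, §L2.1; LÖW's
output B2∕B3, §L2.2) and MONOTONE + BOUNDED in the depth (LÖW's mechanism B1∕B2: Jensen under block averaging +
printed k-uniform bounds).  This file types both as producers of the TAIL MODULUS `∀ j ≥ k, |a j − a_∞| ≤ c k`, `c → 0`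
consumed by `NE7PairwiseScaleShift.nullShift_of_split` for the one-loop coefficients `β⁰_k` (§1, §2), and records the
junction (§3): IF the one-loop coefficients of the printed split ([Balaban1987RG1] (2.12)–(2.14) p. 268, tree
`B12Beta.OneLoopSplit`) are NONDECREASING IN THE DEPTH (hypothesis shape «per-shell positivity of the vacuum
polarisation» — NOT PRINTED, NOT claimed; it is the crux refuter's information rider LÖW-b₀(k) ∕ P-LÖW-2 to balaban-calc,
expected sign «yes») and BOUNDED ABOVE (PRINTED as an inductive property: p. 264 «uniformly bounded on this interval»,
tree `FlowStep.BetaUpperH`-type), THEN the β⁰-half `c₀` of the marginal ask (σ) is NULL with NO RATE and NO appeal to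
G-an2-4's (CONV-C) — the one place on the route where «null» is delivered by something other than a rate.  Honest scope:
this covers `β⁰` only under the displayed sign hypothesis; the remainder's modulus `σ₁` (wall (γ2)∕(γ3)) is untouched,
and LÖW's Jensen monotonicity of the Gaussian operators does NOT imply the sign (β⁰ is a background DERIVATIVE —
ROUTES-NE7 §L2.2 LÖW-res).

WHAT IS PROVED ([folklore]).
§1 `nullTail_of_summable_increments` — `Summable (k ↦ |a (k+1) − a k|)` ⟹ with `a_∞ := lim a` and
   `c k := Σ_{i≥k} |a (i+1) − a i|`: `∀ j ≥ k, |a j − a_∞| ≤ c k` and `c → 0` (BV ⟹ null tail modulus).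
§2 `nullTail_of_monotone_bddAbove` — `Monotone a`, `∀ k, a k ≤ B` ⟹ with `a_∞ := ⨆ a`, `c k := a_∞ − a k`:
   `∀ j ≥ k, |a j − a_∞| ≤ c k`, `c → 0` (monotone convergence ⟹ null tail modulus, no rate).
§3 **`nullShift_of_monotone_split`** — `B12Beta.OneLoopSplit` with `β⁰` nondecreasing and bounded above + (σ¹) for the
   remainder ⟹ (σ) for `β` with `σ = 2(β⁰_∞ − β⁰_k) + σ₁ k`, and `tendsto_monotone_splitShift` (`σ → 0` when `σ₁ → 0`).

NOT DELIVERED: the sign of `β⁰_{k+1} − β⁰_k` for [Balaban1987RG1]'s (5.42) (rider LÖW-b₀(k)); `σ₁`; anything printed.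
NOT NE7 (spine 0/9 unchanged), NOT summit progress.  HONEST DEPENDENCY: continuum YM on T⁴ ⇐ BetaPertH ∧ nine spine
estimates (0/9 proved); BetaPertH ⇐ (D1) ∧ (D4) ∧ CAP+tail; G-an2-4 gates asym, D1 and NE2/3/4.
-/

noncomputable section

open Finset Filter Topology
open scoped BigOperators

namespace Summit.QuantumFields.BalabanUV.T4Continuum.NE7PairwiseMonotone

open Literature.MathematicalPhysics.QuantumFieldTheory.Balaban1983to89
open Literature.MathematicalPhysics.QuantumFieldTheory.Balaban1983to89.FlowStep

/-! ## §1 Bounded variation in the depth ⟹ a null tail modulus (route ℓ¹'s currency ⟹ the null currency) -/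

/-- **BV ⟹ NULL TAIL MODULUS.**  If the increments of a real sequence are summable, then the sequence converges to some
`a_∞`, and `|a j − a_∞| ≤ Σ_{i ≥ k} |a (i+1) − a i|` for all `j ≥ k`, the right side tending to `0` — a tail modulus of
the form consumed by `NE7PairwiseScaleShift.nullShift_of_split`, with no rate. [folklore] -/
theorem nullTail_of_summable_increments {a : ℕ → ℝ} (h : Summable fun k => |a (k + 1) - a k|) :
    ∃ ainf : ℝ, ∃ c : ℕ → ℝ, (∀ k j, k ≤ j → |a j - ainf| ≤ c k) ∧ Tendsto c atTop (𝓝 0) := by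
  -- the sequence is Cauchy, hence convergent
  set d : ℕ → ℝ := fun k => |a (k + 1) - a k| with hd_def
  have hd : ∀ k, dist (a k) (a (k + 1)) ≤ d k := fun k => by
    rw [hd_def, Real.dist_eq, abs_sub_comm]
  have hcau : CauchySeq a := cauchySeq_of_dist_le_of_summable d hd h
  obtain ⟨ainf, hlim⟩ := cauchySeq_tendsto_of_complete hcau
  refine ⟨ainf, fun k => ∑' m, d (m + k), ?_, ?_⟩
  · intro k j hkj
    -- `dist (a j) ainf ≤ Σ_{m ≥ j} d m ≤ Σ_{m ≥ k} d m`
    have hj := dist_le_tsum_of_dist_le_of_tendsto d hd h hlim j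
    rw [Real.dist_eq] at hj
    refine hj.trans ?_
    -- compare the two tails through the full sum: tail_j = total − Σ_{i<j}, tail_k = total − Σ_{i<k}
    have ej := h.sum_add_tsum_nat_add j
    have ek := h.sum_add_tsum_nat_add k
    have hmono : ∑ i ∈ range k, d i ≤ ∑ i ∈ range j, d i :=
      sum_le_sum_of_subset_of_nonneg (range_mono hkj) fun i _ _ => abs_nonneg _
    have e1 : ∑' m, d (j + m) = ∑' m, d (m + j) := tsum_congr fun m => by rw [add_comm]
    rw [e1]
    linarith
  · -- the tails of a summable series tend to zero
    exact tendsto_sum_nat_add d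

/-! ## §2 Monotone + bounded in the depth ⟹ a null tail modulus (LÖW's mechanism ⟹ the null currency) -/

/-- **MONOTONE + BOUNDED ⟹ NULL TAIL MODULUS (no rate).**  A nondecreasing real sequence bounded above converges to its
supremum `a_∞`, and `|a j − a_∞| = a_∞ − a j ≤ a_∞ − a k` for `j ≥ k`, with `a_∞ − a k → 0`. [folklore] -/
theorem nullTail_of_monotone_bddAbove {a : ℕ → ℝ} {B : ℝ} (hmono : Monotone a) (hB : ∀ k, a k ≤ B) :
    ∃ ainf : ℝ, (∀ k, a k ≤ ainf) ∧ (∀ k j, k ≤ j → |a j - ainf| ≤ ainf - a k) ∧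
      Tendsto (fun k => ainf - a k) atTop (𝓝 0) := by
  have hbdd : BddAbove (Set.range a) := ⟨B, by rintro _ ⟨k, rfl⟩; exact hB k⟩
  have hlim := tendsto_atTop_ciSup hmono hbdd
  refine ⟨⨆ k, a k, fun k => le_ciSup hbdd k, fun k j hkj => ?_, ?_⟩
  · rw [abs_sub_comm, abs_of_nonneg (sub_nonneg.mpr (le_ciSup hbdd j))]
    linarith [hmono hkj]
  · have := hlim.const_sub (⨆ k, a k)
    simpa using this

/-! ## §3 Junction with the marginal ask (σ): monotone one-loop coefficients -/

/-- **(σ) FOR THE FULL β FROM A MONOTONE ONE-LOOP LADDER.**  For the printed one-loop split `β = β⁰ + β¹`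
(`B12Beta.OneLoopSplit`): IF the one-loop coefficients are NONDECREASING in the depth (`∀ k, β⁰_k ≤ β⁰_{k+1}` — the
«per-shell positivity» hypothesis shape, NOT PRINTED, NOT claimed: the crux refuter's rider LÖW-b₀(k) ∕ P-LÖW-2) and
BOUNDED ABOVE (`β⁰_k ≤ B` — printed-type uniform bound, p. 264), and the remainder satisfies (σ¹) with modulus `σ₁`, THEN
(σ) holds for `β` with `σ k = 2(β⁰_∞ − β⁰_k) + σ₁ k`, `β⁰_∞ = sup_k β⁰_k` — the β⁰-half of the route's marginal ask
delivered by monotone convergence, WITHOUT a rate and without G-an2-4's (CONV-C). [folklore] -/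
theorem nullShift_of_monotone_split {β : HBeta} (S : B12Beta.OneLoopSplit β) {γ B : ℝ} {σ₁ : ℕ → ℝ}
    (hmono : Monotone S.β0) (hB : ∀ k, S.β0 k ≤ B)
    (hrem : ∀ n k (w : ℕ → ℝ), (∀ i, i ≤ k + n → 0 < w i ∧ w i ≤ γ) →
      |S.β1 (k + n) (prefixOf w (k + n)) - S.β1 k (prefixOf (fun i => w (i + n)) k)| ≤ σ₁ k) :
    ∃ binf : ℝ, (∀ n k (w : ℕ → ℝ), (∀ i, i ≤ k + n → 0 < w i ∧ w i ≤ γ) →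
        |β (k + n) (prefixOf w (k + n)) - β k (prefixOf (fun i => w (i + n)) k)| ≤ 2 * (binf - S.β0 k) + σ₁ k) ∧
      Tendsto (fun k => binf - S.β0 k) atTop (𝓝 0) := by
  obtain ⟨binf, _, htail, hlim⟩ := nullTail_of_monotone_bddAbove hmono hB
  exact ⟨binf, NE7PairwiseScaleShift.nullShift_of_split S (c₀ := fun k => binf - S.β0 k) htail hrem, hlim⟩

/-- The monotone-split modulus is null when the remainder's is: `β⁰_∞ − β⁰_k → 0` (given) and `σ₁ → 0` ⟹
`2(β⁰_∞ − β⁰_k) + σ₁ k → 0` — the hypothesis `hσ0` of `NE7PairwiseCouplingDock.couplingGap_tendsto_zero`. [folklore] -/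
theorem tendsto_monotone_splitShift {b0 : ℕ → ℝ} {binf : ℝ} {σ₁ : ℕ → ℝ}
    (hlim : Tendsto (fun k => binf - b0 k) atTop (𝓝 0)) (hσ : Tendsto σ₁ atTop (𝓝 0)) :
    Tendsto (fun k => 2 * (binf - b0 k) + σ₁ k) atTop (𝓝 0) :=
  NE7PairwiseScaleShift.tendsto_splitShift hlim hσ

end Summit.QuantumFields.BalabanUV.T4Continuum.NE7PairwiseMonotone

end
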